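import Mathlib
import HarnessLib
import Summits.ResolutionOfSingularities.ResolutionOfSingularities.Theorems.HomologicalConductorPersistenceKC3FrobeniusOrderBasis

/-!
# K-SD0 branch (ii) SD-K1 — the DEFORMED NORMALISATIONS `A_u = k[a⁶ + u·abc, b³, c²]` of
# `W₀ = k[a,b,c]^{μ₆(1,2,3)}`, I: definitions and TRIANGULARITY (chain W4.4b, seat res-L1-w44b-stub-4 gen 5;
# kernel half of «b³c² ∈ ca⁴(T₁)», CHAIN v13.13 §V13.21.8)

[OURS · L1 w44b · K-SD0 stmt-16485 / rung S-2] Nothing here is a statement of the manuscript under review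
(Hironaka 2017); AI-written, weaker than expert review.

WHY.  The SD-K1 step of the kill test K-SD0 (crux `StrictDrop`, stmt-ResolutionOfSingularities-16485) reads the
Newton polyhedron of `ca(T₁)`, `T₁ = W₀ = k[a,b,c]^{μ₆(1,2,3)}` (res-D-pv-037's `kc3W`), whose `(1,1,1)`-face is
the vertex `b³c²` (res-L1-w44b-plan-1 kit j283499, res-L1-w44b-tri-1 REFEREE-SDK1P: the 16 weight-12 monomials
`≠ b⁶, c⁴, abc³` = the `3 × 3` Jacobian minors of the Hilbert basis lie in the Noether different over GENERIC
linear normalisations).  The monomial normalisation `P₀ = k[a⁶,b³,c²]` (`…KC3FrobeniusOrderBasis`) cannot see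
`b³c²`: `𝔑(W₀/P₀) = (a⁵b²c)`.  The cheapest normalisation that does is the one-parameter deformation
`A_u = k[a⁶ + u·abc, b³, c²]` (`u ∈ k`; Jacobian `J(a⁶ + u·abc, b³, c²) = 36 a⁵b²c + 6u·b³c²`), and the different
floor `𝔑(W₀/A_u) ⊆ ca⁴(W₀)` (tree `noetherDifferent_le_cohomologyAnnihilatorOfDegree_of_projective`) needs
`W₀` PROJECTIVE over `A_u` — Hironaka's «Cohen–Macaulay ⇒ free over every h.s.o.p.», which the tree does not
have.  This file proves the instance needed, by LEADING TERMS: in the lexicographic order `a > b > c` the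
leading monomial of `(a⁶ + u·abc)^i b^{3j} c^{2l}` is `a^{6i} b^{3j} c^{2l}`, so the `P₀`-coefficient extraction of
`…KC3FrobeniusOrderBasis` survives the deformation (an `a`-degree filtration argument, no Gröbner theory).

RESULTS (`u : k` arbitrary; `u = 0` recovers `P₀`).
* `θu k u : k[A,B,C] →ₐ k[a,b,c]`, `A ↦ a⁶ + u·abc, B ↦ b³, C ↦ c²` (`θu_monomial`, `θu_mem_kc3W`);
  `kc3Au u := (θu k u).range ⊆ W₀`, the `↥(kc3Au u)`-algebra structure `kc3W.algebraAu` on `↥W₀` by inclusion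
  (`coe_smul_kc3Au`), `θuA u` the co-restriction.
* **`coeff_theta_pow_mul_monomial`** — TRIANGULARITY: the coefficients of `(a⁶ + u·abc)ⁿ · (c·xᴱ)` live at
  `x^{E + (6n,0,0)}` (coefficient `c`) and at exponents of SMALLER `a`-degree; `coeff_θu_monomial_mul_box_ne_zero`,
  `coeff_θu_monomial_mul_box_top` — the same for `θ_u(c·A^iB^jC^l) · x^{box n}` with top exponent `box n + sc q`.
The basis (`coordAu` bijective, `Module.Free/Finite ↥(kc3Au u) ↥W₀`, `θu_injective`) is the sibling file
`…KC3JacobianFloorBasis.lean`; the different floor `b³c² ∈ ca⁴(W₀)` is `…KC3JacobianFloor.lean`.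

References: M. Hochster, J. Eagon (1971) / H. Hironaka (CM ⇒ free over an h.s.o.p.), folklore; the K-C3 files of
res-D-pv-037 (`…KC3FrobeniusOrderDefs/Basis`).
-/

noncomputable section

-- single-problem summit: the doubled namespace component `ResolutionOfSingularities` is forced
set_option linter.dupNamespace false

open MvPolynomial

universe u

namespace Summit.ResolutionOfSingularities.ResolutionOfSingularities.Theorems.HomologicalConductor.KC3JacobianFloor

open Summit.ResolutionOfSingularities.ResolutionOfSingularities.Theorems.HomologicalConductor.KC3Witness
  (e e_apply_zero e_apply_one e_apply_two e_add e_zero e_le_iff e_sub)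
open Summit.ResolutionOfSingularities.ResolutionOfSingularities.Theorems.HomologicalConductor.KC3FrobeniusOrder

variable {k : Type u} [Field k]

/-! ## The deformed normalisation `θ_u : A ↦ a⁶ + u·abc, B ↦ b³, C ↦ c²` -/

variable (k) in
/-- `θ_u : k[A,B,C] → k[a,b,c]`, `A ↦ a⁶ + u·abc`, `B ↦ b³`, `C ↦ c²` (`u = 0`: res-D-pv-037's `kc3θ`).
[OURS · L1 w44b] -/
def θu (u : k) : MvPolynomial (Fin 3) k →ₐ[k] MvPolynomial (Fin 3) k :=
  aeval ![monomial (e 6 0 0) 1 + monomial (e 1 1 1) u, monomial (e 0 3 0) 1, monomial (e 0 0 2) 1]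

variable (u : k)

/-- `θ_u(A) = a⁶ + u·abc`. [OURS · bookkeeping] -/
@[simp] theorem θu_X_zero : θu k u (X 0) = monomial (e 6 0 0) 1 + monomial (e 1 1 1) u := by
  simp [θu]

/-- `θ_u(B) = b³`. [OURS · bookkeeping] -/
@[simp] theorem θu_X_one : θu k u (X 1) = monomial (e 0 3 0) 1 := by simp [θu]

/-- `θ_u(C) = c²`. [OURS · bookkeeping] -/
@[simp] theorem θu_X_two : θu k u (X 2) = monomial (e 0 0 2) 1 := by simp [θu]

/-- `θ_u` on monomials: `θ_u(c·AⁱBʲCˡ) = (a⁶ + u·abc)ⁱ · c·b^{3j}c^{2l}`. [OURS · bookkeeping] -/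
theorem θu_monomial (q : Fin 3 →₀ ℕ) (c : k) :
    θu k u (monomial q c) =
      (monomial (e 6 0 0) 1 + monomial (e 1 1 1) u) ^ q 0 * monomial (e 0 (3 * q 1) (2 * q 2)) c := by
  rw [θu, aeval_monomial, Finsupp.prod_pow, Fin.prod_univ_three, algebraMap_eq]
  simp only [Matrix.cons_val_zero, Matrix.cons_val_one, Matrix.cons_val_two, Matrix.tail_cons,
    Matrix.head_cons, monomial_pow, one_pow]
  have : monomial (e 0 (3 * q 1) (2 * q 2)) c =
      C c * (monomial (q 1 • e 0 3 0) (1 : k) * monomial (q 2 • e 0 0 2) 1) := by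
    rw [monomial_mul, C_mul_monomial, mul_one, mul_one,
      show q 1 • e 0 3 0 + q 2 • e 0 0 2 = e 0 (3 * q 1) (2 * q 2) from by
        ext i; fin_cases i <;> simp [mul_comm]]
  rw [this]
  ring

/-- `θ_u` lands in `W₀`. [OURS · L1 w44b] -/
theorem θu_mem_kc3W (p : MvPolynomial (Fin 3) k) : θu k u p ∈ kc3W k := by
  induction p using MvPolynomial.induction_on with
  | C a => rw [θu, aeval_C, algebraMap_eq]; exact (kc3W k).algebraMap_mem a
  | add p q hp hq => rw [map_add]; exact add_mem hp hq
  | mul_X p i hp =>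
    rw [map_mul]
    refine mul_mem hp ?_
    fin_cases i
    · rw [show ((⟨0, by norm_num⟩ : Fin 3)) = 0 from rfl, θu_X_zero]
      exact add_mem (monomial_mem_kc3W (by simp [wt]) _) (monomial_mem_kc3W (by simp [wt]) _)
    · rw [show ((⟨1, by norm_num⟩ : Fin 3)) = 1 from rfl, θu_X_one]
      exact monomial_mem_kc3W (by simp [wt]) _
    · rw [show ((⟨2, by norm_num⟩ : Fin 3)) = 2 from rfl, θu_X_two]
      exact monomial_mem_kc3W (by simp [wt]) _

/-- `A_u = k[a⁶ + u·abc, b³, c²] ⊆ k[a,b,c]`, the range of `θ_u`. [OURS · L1 w44b] -/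
def kc3Au : Subalgebra k (MvPolynomial (Fin 3) k) := (θu k u).range

/-- `A_u ⊆ W₀`. [OURS · L1 w44b] -/
theorem kc3Au_le_kc3W : kc3Au u ≤ kc3W k := by
  rintro _ ⟨p, rfl⟩
  exact θu_mem_kc3W u p

/-- **The `A_u`-algebra structure on `W₀`** by the inclusion `A_u ⊆ W₀`. [OURS · L1 w44b] -/
instance kc3W.algebraAu : Algebra ↥(kc3Au u) ↥(kc3W k) :=
  (Subalgebra.inclusion (kc3Au_le_kc3W u)).toRingHom.toAlgebra

/-- The structure map is the inclusion. [OURS · bookkeeping] -/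
theorem coe_algebraMap_kc3Au (p : ↥(kc3Au u)) :
    ((algebraMap ↥(kc3Au u) ↥(kc3W k) p : ↥(kc3W k)) : MvPolynomial (Fin 3) k) =
      (p : MvPolynomial (Fin 3) k) :=
  Subalgebra.coe_inclusion (kc3Au_le_kc3W u) p

/-- Scalar multiplication by `A_u` inside `k[a,b,c]`: `↑(p • w) = ↑p * ↑w`. [OURS · bookkeeping] -/
theorem coe_smul_kc3Au (p : ↥(kc3Au u)) (w : ↥(kc3W k)) :
    ((p • w : ↥(kc3W k)) : MvPolynomial (Fin 3) k) =
      (p : MvPolynomial (Fin 3) k) * (w : MvPolynomial (Fin 3) k) := by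
  rw [Algebra.smul_def, Subalgebra.coe_mul, coe_algebraMap_kc3Au]

/-- `k → A_u → W₀` is a scalar tower. [OURS · bookkeeping] -/
instance kc3W.isScalarTowerAu : IsScalarTower k ↥(kc3Au u) ↥(kc3W k) :=
  IsScalarTower.of_algebraMap_eq fun c => Subtype.ext (by
    rw [coe_algebraMap_kc3Au, Subalgebra.coe_algebraMap, Subalgebra.coe_algebraMap])

/-- `θ_u` co-restricted to its range `A_u`. [OURS · bookkeeping] -/
def θuA : MvPolynomial (Fin 3) k →ₐ[k] ↥(kc3Au u) := (θu k u).rangeRestrict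

/-- The underlying polynomial of `θuA u p` is `θ_u p`. [OURS · bookkeeping] -/
@[simp] theorem coe_θuA (p : MvPolynomial (Fin 3) k) : (θuA u p : MvPolynomial (Fin 3) k) = θu k u p := rfl

/-- `θuA` is onto `A_u`. [OURS · bookkeeping] -/
theorem θuA_surjective : Function.Surjective (θuA u) := (θu k u).rangeRestrict_surjective


/-! ## Triangularity of the deformation: the `a`-degree filtration -/

/-- **Triangularity.** The coefficients of `(a⁶ + u·abc)ⁿ · (c·xᴱ)` sit at `xᴱ⁺⁽⁶ⁿ,⁰,⁰⁾` (coefficient `c`)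
and otherwise only at exponents of STRICTLY SMALLER `a`-degree than `E₀ + 6n` (induction on `n`:
`(a⁶ + u·abc)·m` raises the `a`-degree of a monomial `m` by `6` or by `1`). [OURS · L1 w44b] -/
theorem coeff_theta_pow_mul_monomial (n : ℕ) (E : Fin 3 →₀ ℕ) (c : k) :
    (∀ D : Fin 3 →₀ ℕ,
      coeff D ((monomial (e 6 0 0) 1 + monomial (e 1 1 1) u) ^ n * monomial E c) ≠ 0 →
        D = E + e (6 * n) 0 0 ∨ D 0 < E 0 + 6 * n) ∧
    coeff (E + e (6 * n) 0 0) ((monomial (e 6 0 0) 1 + monomial (e 1 1 1) u) ^ n * monomial E c) = c := by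
  induction n with
  | zero =>
    refine ⟨fun D hD => ?_, ?_⟩
    · rw [pow_zero, one_mul, coeff_monomial] at hD
      by_cases h : E = D
      · left; rw [← h, Nat.mul_zero, e_zero, add_zero]
      · exact absurd (if_neg h) hD
    · rw [Nat.mul_zero, e_zero, add_zero, pow_zero, one_mul, coeff_monomial, if_pos rfl]
  | succ n ih =>
    obtain ⟨ih₁, ih₂⟩ := ih
    have hexp : ∀ D : Fin 3 →₀ ℕ,
        coeff D ((monomial (e 6 0 0) 1 + monomial (e 1 1 1) u) ^ (n + 1) * monomial E c) =
          (if e 6 0 0 ≤ D then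
              coeff (D - e 6 0 0) ((monomial (e 6 0 0) 1 + monomial (e 1 1 1) u) ^ n * monomial E c)
            else 0) +
          (if e 1 1 1 ≤ D then
              u * coeff (D - e 1 1 1) ((monomial (e 6 0 0) 1 + monomial (e 1 1 1) u) ^ n * monomial E c)
            else 0) := by
      intro D
      rw [pow_succ', mul_assoc, add_mul, coeff_add, coeff_monomial_mul', coeff_monomial_mul', one_mul]
    refine ⟨fun D hD => ?_, ?_⟩
    · rw [hexp] at hD
      by_cases h6 : e 6 0 0 ≤ D
      · by_cases hA : coeff (D - e 6 0 0) ((monomial (e 6 0 0) 1 + monomial (e 1 1 1) u) ^ n *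
            monomial E c) = 0
        · -- only the `abc`-branch can contribute
          rw [if_pos h6, hA, zero_add] at hD
          by_cases h1 : e 1 1 1 ≤ D
          · rw [if_pos h1] at hD
            have hB : coeff (D - e 1 1 1) ((monomial (e 6 0 0) 1 + monomial (e 1 1 1) u) ^ n *
                monomial E c) ≠ 0 := fun h => hD (by rw [h, mul_zero])
            have h10 : 1 ≤ D 0 := by simpa using h1 0
            right
            rcases ih₁ _ hB with h | h
            · have := congrArg (· 0) h
              simp only [Finsupp.coe_tsub, Pi.sub_apply, e_apply_zero, Finsupp.coe_add,
                Pi.add_apply] at this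
              omega
            · simp only [Finsupp.coe_tsub, Pi.sub_apply, e_apply_zero] at h
              omega
          · rw [if_neg h1] at hD; exact absurd rfl hD
        · have h60 : 6 ≤ D 0 := by simpa using h6 0
          rcases ih₁ _ hA with h | h
          · left
            rw [← tsub_add_cancel_of_le h6, h, add_assoc, e_add,
              show 6 * n + 6 = 6 * (n + 1) by ring]
          · right
            simp only [Finsupp.coe_tsub, Pi.sub_apply, e_apply_zero] at h
            omega
      · rw [if_neg h6, zero_add] at hD
        by_cases h1 : e 1 1 1 ≤ D
        · rw [if_pos h1] at hD
          have hB : coeff (D - e 1 1 1) ((monomial (e 6 0 0) 1 + monomial (e 1 1 1) u) ^ n *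
              monomial E c) ≠ 0 := fun h => hD (by rw [h, mul_zero])
          have h10 : 1 ≤ D 0 := by simpa using h1 0
          right
          rcases ih₁ _ hB with h | h
          · have := congrArg (· 0) h
            simp only [Finsupp.coe_tsub, Pi.sub_apply, e_apply_zero, Finsupp.coe_add,
              Pi.add_apply] at this
            omega
          · simp only [Finsupp.coe_tsub, Pi.sub_apply, e_apply_zero] at h
            omega
        · rw [if_neg h1] at hD; exact absurd rfl hD
    · rw [hexp]
      have h6 : e 6 0 0 ≤ E + e (6 * (n + 1)) 0 0 := by
        intro i; fin_cases i <;> simp; omega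
      have hsub : E + e (6 * (n + 1)) 0 0 - e 6 0 0 = E + e (6 * n) 0 0 := by
        ext i; fin_cases i <;> simp; omega
      rw [if_pos h6, hsub, ih₂]
      by_cases h1 : e 1 1 1 ≤ E + e (6 * (n + 1)) 0 0
      · rw [if_pos h1]
        have hz : coeff (E + e (6 * (n + 1)) 0 0 - e 1 1 1)
            ((monomial (e 6 0 0) 1 + monomial (e 1 1 1) u) ^ n * monomial E c) = 0 := by
          by_contra hne
          rcases ih₁ _ hne with h | h
          · have := congrArg (· 0) h
            simp only [Finsupp.coe_tsub, Pi.sub_apply, e_apply_zero, Finsupp.coe_add,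
              Pi.add_apply] at this
            omega
          · simp only [Finsupp.coe_tsub, Pi.sub_apply, e_apply_zero, Finsupp.coe_add, Pi.add_apply] at h
            omega
        rw [hz, mul_zero, add_zero]
      · rw [if_neg h1, add_zero]

/-- The coefficients of `θ_u(c·A^i B^j C^l) · x^{box n}` away from the top exponent `box n + sc q` have smaller
`a`-degree. [OURS · L1 w44b] -/
theorem coeff_θu_monomial_mul_box_ne_zero {q : Fin 3 →₀ ℕ} {c : k} {n : Fin 6} {D : Fin 3 →₀ ℕ}
    (hD : coeff D (θu k u (monomial q c) * monomial (box n) 1) ≠ 0) :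
    D = box n + sc q ∨ D 0 < (box n + sc q) 0 := by
  have key := (coeff_theta_pow_mul_monomial u (q 0) (box n + e 0 (3 * q 1) (2 * q 2)) c).1 D
  have hrw : θu k u (monomial q c) * monomial (box n) 1 =
      (monomial (e 6 0 0) 1 + monomial (e 1 1 1) u) ^ q 0 *
        monomial (box n + e 0 (3 * q 1) (2 * q 2)) c := by
    rw [θu_monomial, mul_assoc, monomial_mul, mul_one, add_comm (e 0 _ _)]
  rw [hrw] at hD
  have hsc : box n + e 0 (3 * q 1) (2 * q 2) + e (6 * q 0) 0 0 = box n + sc q := by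
    rw [add_assoc, e_add]; congr 1; ext i; fin_cases i <;> simp [sc]
  rcases key hD with h | h
  · left; rw [h, hsc]
  · right
    simp only [Finsupp.coe_add, Pi.add_apply, e_apply_zero, sc_apply_zero] at h ⊢
    omega

/-- The top coefficient: `coeff_{box n + sc q} (θ_u(c·A^q) · x^{box n}) = c`. [OURS · L1 w44b] -/
theorem coeff_θu_monomial_mul_box_top (q : Fin 3 →₀ ℕ) (c : k) (n : Fin 6) :
    coeff (box n + sc q) (θu k u (monomial q c) * monomial (box n) 1) = c := by
  have key := (coeff_theta_pow_mul_monomial u (q 0) (box n + e 0 (3 * q 1) (2 * q 2)) c).2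
  have hrw : θu k u (monomial q c) * monomial (box n) 1 =
      (monomial (e 6 0 0) 1 + monomial (e 1 1 1) u) ^ q 0 *
        monomial (box n + e 0 (3 * q 1) (2 * q 2)) c := by
    rw [θu_monomial, mul_assoc, monomial_mul, mul_one, add_comm (e 0 _ _)]
  have hsc : box n + e 0 (3 * q 1) (2 * q 2) + e (6 * q 0) 0 0 = box n + sc q := by
    rw [add_assoc, e_add]; congr 1; ext i; fin_cases i <;> simp [sc]
  rw [hrw, ← hsc, key]

end Summit.ResolutionOfSingularities.ResolutionOfSingularities.Theorems.HomologicalConductor.KC3JacobianFloor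

end
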